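import Literature.NumberTheory.EllipticCurves.TakahashiDegreeFormulaFromDictionaryHolds
import Literature.NumberTheory.Automorphic.ShimuraCurveRibetTakahashiPairwiseEisensteinProofs
import HarnessLib

/-!
# Stub ideation k1, GEN 7 (FAMILY 1 — recognise & import) for `stub_takahashi`
# (crux `DefiniteXi.DefiniteRTControlPrime`, stmt-ABC-11338) — companion of
# `STUB-IDEAS-stub_takahashi-1.md` (gen 7)

Gen 7 adds NO new leaf.  It records, kernel-checked, the one regime fact the critic needs to rank the
gen-6 plan (`StubIdeas1G6TakahashiSketch.lean`, leaves `H2flat` = D1, `H1`, `H0`; assemblies A1–A11):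

* `rankOne_of_squarefree_cofactor` — the multiplicity-one leaf `H1` is ALREADY A TREE THEOREM whenever
  the cofactor `M` is square-free (`takahashi2001_brandtEigenLattice_rank_one_holds`, proved through
  Eichler–Selberg/Popa + Eichler's Brandt trace formula), i.e. for every SEMISTABLE Frey curve
  (`N = M q` square-free); the open part of `H1` is exactly the additive-at-2 regime `4 ∣ M`.
* `stub_of_dict_semistable` — hence, at square-free level, the stub's conclusion follows from the
  dictionary leaf D1 (= gen-6 `H2flat`) ALONE.
-/

set_option linter.dupNamespace false

noncomputable section

namespace Summit.ABC.ABC.Cruxes.DefiniteRTControlPrime.StubIdeas1G7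

open Literature.NumberTheory.EllipticCurves Literature.NumberTheory.EllipticCurves.ModularForms
open Literature.NumberTheory.Automorphic
open scoped BigOperators

/-- **D1 = gen-6 `H2flat` VERBATIM** (copied so that this file imports only built Literature
modules): the `D = 1`, `r ∥ N` character-group dictionary WITHOUT multiplicity one — `hDict` of
`…PairwiseEisensteinProofs.lean` minus its `finrank … = 1` conjunct.  Proposed tree name:
`Literature.NumberTheory.EllipticCurves.takahashi2001_characterGroupDictionary_of_coprime`. -/
def D1 : Prop :=
  ∀ (W : WeierstrassCurve ℚ) [W.IsElliptic] (M r : ℕ) [NeZero (M * r)],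
    r.Prime → M.Coprime r → W.conductorNorm ℤ = M * r →
    ∀ P : ModularParametrizationData W (M * r),
      (∀ (W' : WeierstrassCurve ℚ) [W'.IsElliptic], W'.conductorNorm ℤ = M * r →
          ∀ P' : ModularParametrizationData W' (M * r),
          P'.f = P.f → P.modularDegree ≤ P'.modularDegree) →
      ∀ (S : Brandt.XiSetup M r) [Fintype (Brandt.ClassSet S.O)],
        ∃ (X : Submodule ℤ (Brandt.ClassSet S.O → ℤ)) (pb : ℤ →ₗ[ℤ] X) (pf : X →ₗ[ℤ] ℤ),
          (∀ (a : ℤ) (y : X),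
              ∑ i, (Brandt.weight S.O i : ℤ) * (pb a : Brandt.ClassSet S.O → ℤ) i *
                  (y : Brandt.ClassSet S.O → ℤ) i =
                ((W.minimalDiscriminantNorm ℤ).factorization r : ℤ) * a * pf y) ∧
          (∀ a : ℤ, pf (pb a) = (P.modularDegree : ℤ) * a) ∧
          Function.Surjective pf ∧
          (∀ (m : ℤ) (v : Brandt.ClassSet S.O → ℤ), m ≠ 0 → m • v ∈ X → v ∈ X) ∧
          (∀ v : Brandt.ClassSet S.O → ℤ, ∑ i, v i = 0 → v ∈ X) ∧
          (pb 1 : Brandt.ClassSet S.O → ℤ) ∈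
            Brandt.eigenLattice (M * r) (Brandt.matrix S.O) (fun n => W.LFunction n)

/-- **H1 in the semistable regime is proved**: for `M` square-free and coprime to the prime `r`,
`M r` is square-free, so the tree theorem `takahashi2001_brandtEigenLattice_rank_one_holds` gives the
rank-one statement of gen-6 `H1` verbatim. [cite: Takahashi2001, §2 p. 78] -/
theorem rankOne_of_squarefree_cofactor (W : WeierstrassCurve ℚ) [W.IsElliptic] (M r : ℕ)
    [NeZero (M * r)] (hr : r.Prime) (hM : Squarefree M) (hcop : M.Coprime r)
    (hN : W.conductorNorm ℤ = M * r) (P : ModularParametrizationData W (M * r))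
    (S : Brandt.XiSetup M r) [Fintype (Brandt.ClassSet S.O)] :
    Module.finrank ℤ
      (Brandt.eigenLattice (M * r) (Brandt.matrix S.O) (fun n => W.LFunction n)) = 1 :=
  takahashi2001_brandtEigenLattice_rank_one_holds W M r hr
    ((Nat.squarefree_mul hcop).mpr ⟨hM, hr.squarefree⟩) hN P S

/-- **The stub's conclusion at square-free level from the dictionary leaf D1 (`D1` = gen-6 `H2flat`) alone**
(multiplicity one supplied by `rankOne_of_squarefree_cofactor`; the assembly is gen-6 `A2`/`A3` run
pointwise through the tree's `exists_image_coker_eisenstein_of_brandtData`). -/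
theorem stub_of_dict_semistable (hD : D1) (W : WeierstrassCurve ℚ) [W.IsElliptic] (M r : ℕ)
    [NeZero (M * r)] (hr : r.Prime) (hM : Squarefree M) (hcop : M.Coprime r)
    (hN : W.conductorNorm ℤ = M * r) (P : ModularParametrizationData W (M * r))
    (hmin : ∀ (W' : WeierstrassCurve ℚ) [W'.IsElliptic], W'.conductorNorm ℤ = M * r →
        ∀ P' : ModularParametrizationData W' (M * r),
        P'.f = P.f → P.modularDegree ≤ P'.modularDegree)
    (S : Brandt.XiSetup M r) :
    ∃ i j : ℕ, 0 < i ∧ i * j = (W.minimalDiscriminantNorm ℤ).factorization r ∧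
      i ∣ S.xi (fun n => W.LFunction n) ∧
      P.modularDegree * i = S.xi (fun n => W.LFunction n) * j := by
  classical
  letI : Fintype (Brandt.ClassSet S.O) := Fintype.ofFinite _
  obtain ⟨X, pb, pf, hadj, hδ, hsurj, hsat, hdeg, hmem⟩ := hD W M r hr hcop hN P hmin S
  obtain ⟨i, j, hi, hij, hiξ, hδi, -⟩ := exists_image_coker_eisenstein_of_brandtData W M r hr hN P S
    X pb pf hadj hδ hsurj hsat hdeg (rankOne_of_squarefree_cofactor W M r hr hM hcop hN P S) hmem
  exact ⟨i, j, hi, hij, hiξ, hδi⟩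

end Summit.ABC.ABC.Cruxes.DefiniteRTControlPrime.StubIdeas1G7

end
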